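import Summits.ValiantsHypothesis.ValiantsHypothesis.Theorems.BarrierLeverChowBenchmarkPairsDualisation

/-!
# Route BarrierLever — item 22038 `ChowBenchmarkPairs`, line `moore-peel`: the typed node
# CONJECTURE GTN («generic total nonsingularity») and its kernel arrow to `stub_segmentMeanValue`

Helper file (`--supports stmt-ValiantsHypothesis-22038`; cell valiant-natproofs, rung V4, 𝒟-side benchmark of
record; seat val-np-p4 gen 21).  Closes NO item.

The line's open content is `∀ h, SegmentMeanValueAt h` (`Cruxes/ChowBenchmarkPairs/Lines/moore_peel.lean`,
registered stub `stub_segmentMeanValue`): SOME point table `P : Fin h → Fin h → ℂ` makes the segment-moment matrix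
`[segEntry P (u i) (benchCols h r j)]` nonsingular, rows = all `S ⊆ Fin h` with `|S| ≤ 2`, columns = the first
`r = r_h = 1 + h + C(h,2)` binary codes.

**CONJECTURE GTN** (this seat; numerics below) says that the binary-code WINDOW plays no role: for EVERY injective
family of `r_h` column sets `T_j ⊆ Fin h` containing the empty column, some table makes `[segEntry P (u i) (T j)]`
nonsingular.  (The empty column is necessary — `det_eq_zero_of_forall_ne_empty`, via `ChowBenchmarkDual.segSum_empty`: the row
`S = ∅` is the indicator of the empty column; with `h` coordinates the second structural condition of the general conjecture, «at most `h`
singleton columns», is automatic.)  Equivalently: for generic `P` the `r_h × 2^h` matrix with rows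
`1, v_a = R_a − 1, v_a v_b` (`R_a = (1 − Σ_c P_{ac} θ_c)^{-1}` in the zeon algebra `ℂ[θ]/(θ_c²)`) has every maximal
minor through the column `∅` nonzero — the column matroid of the pair-product space is UNIFORM apart from the forced
loop structure.

EVIDENCE (folder num/ of the seat, kit j310432): exact rank mod `2³¹−1` at random tables — (h,k) = (4,4): all 4 368
column subsets; (7,5): all 4 960; (4,5), (5,5), (6,5), (6,6), (7,7): 3 000 / 3 000 / 2 000 / 1 500 / 400 random
admissible subsets; adversarial families at k = h ≤ 7 (all `|T| ≤ 2`; singletons + triples; cones; no singleton columns;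
the `r−1` largest sets; a small sub-cube; co-small sets): no exception.  The stronger «every Hall-feasible square
submatrix (row subset × column subset) is nonsingular» also has no exception in ≈ 4 000 samples (h = 6, k = 4, 6);
«rank = matching number of the support graph» for SPARSE supports is false (proportional points).
WHY IT MIGHT FAIL: a column family whose degree profile starves the pair rows in a way not visible to the support
graph (none found); it is a strengthening of the open stub, so it inherits «a height at which every table is
degenerate».  WHY IT IS USEFUL: it says the ∀h difficulty is NOT the 2-adic shape of `W_h` (Möbius coincidences of
the Moore peel, Ramanujan–Nagell heights) but a uniform-position statement about the map `P ↦ (R_a R_b)_{a<b}`; any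
inductive proof may choose its column sets freely (e.g. the seat's «rigid up-set peeling», which closes the heights
h ∈ {1,2,3,4,8} by block factorisation, needs exactly this freedom for its induction hypothesis).

WHAT THIS IS NOT: no stub of the line is closed; `Stmt.gtn` is a typed CONJECTURE (candidate node, not registered);
nothing on crux stmt-ValiantsHypothesis-14610 or on `VP` versus `VNP`.
-/

set_option linter.dupNamespace false

namespace Summit.ValiantsHypothesis.ValiantsHypothesis.Theorems.BarrierLever.ChowBenchmarkGTN

open Finset
open Summit.ValiantsHypothesis.ValiantsHypothesis.Theorems.BarrierLever.MoorePeel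
  (benchCols benchCols_injective windowStart windowStart_succ windowStart_succ_le_two_pow)
open Summit.ValiantsHypothesis.ValiantsHypothesis.Theorems.BarrierLever.ChowBenchmarkDual
  (eq_windowStart_of_enumeration)

variable {h : ℕ}

/-! ## 1. The typed node -/

/-- **CONJECTURE GTN — generic total nonsingularity of the segment-moment rows** (val-np-p4 g21, 2026-08-28).
For every height `h`, every enumeration `u` of the sets of size `≤ 2` in `Fin h` and EVERY injective family of
column sets `T : Fin r → Finset (Fin h)` containing the empty column, some point table makes the square matrix
`[entry P (u i) (T j)]` nonsingular.  The line's `stub_segmentMeanValue` is the instance `T = benchCols h r`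
(`segmentMeanValue_of_gtn`). -/
def Stmt.gtn : Prop :=
  ∀ (h r : ℕ) (u : Fin r → Finset (Fin h)), Function.Injective u → (∀ i, (u i).card ≤ 2) →
    (∀ S : Finset (Fin h), S.card ≤ 2 → ∃ i, u i = S) →
    ∀ T : Fin r → Finset (Fin h), Function.Injective T → (∃ j, T j = ∅) →
      ∃ P : Fin h → Fin h → ℂ,
        (Matrix.of fun i j : Fin r =>
          ∑ g : (↥(T j) → ↥(u i)), (∏ c : ↥(T j), P (g c) c) *
            ∏ a : ↥(u i), ((Finset.univ.filter fun c : ↥(T j) => g c = a).card.factorial : ℂ)).det ≠ 0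

/-! ## 2. The empty column is necessary -/

/-- **Sharpness of the side condition**: if no column is empty, the row `S = ∅` vanishes and the matrix is
singular for EVERY table. -/
theorem det_eq_zero_of_forall_ne_empty {r : ℕ} (u : Fin r → Finset (Fin h)) (i₀ : Fin r) (hi : u i₀ = ∅)
    (T : Fin r → Finset (Fin h)) (hT : ∀ j, T j ≠ ∅) (P : Fin h → Fin h → ℂ) :
    (Matrix.of fun i j : Fin r =>
      ∑ g : (↥(T j) → ↥(u i)), (∏ c : ↥(T j), P (g c) c) *
        ∏ a : ↥(u i), ((Finset.univ.filter fun c : ↥(T j) => g c = a).card.factorial : ℂ)).det = 0 := by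
  apply Matrix.det_eq_zero_of_row_eq_zero i₀
  intro j
  have := ChowBenchmarkDual.segSum_empty P (T j)
  rw [if_neg (hT j)] at this
  rw [Matrix.of_apply, hi]
  exact this

/-! ## 3. GTN ⟹ the line's `stub_segmentMeanValue` -/

/-- The first benchmark column is the empty set. -/
theorem benchCols_zero {r : ℕ} (hr : 0 < r) : benchCols h r ⟨0, hr⟩ = ∅ := by
  unfold benchCols
  apply Finset.filter_false_of_mem
  intro c _
  simp

/-- **GTN ⟹ `∀ h, SegmentMeanValueAt h`** (the line file's `Stmt.stub_segmentMeanValue`, unfolded verbatim as in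
`ChowBenchmarkDual.stub_dualisation`): instantiate the column family at the binary codes `benchCols h r`
(injective since `r = c_{h+1} ≤ 2^h`; column `0` is empty). -/
theorem segmentMeanValue_of_gtn (H : Stmt.gtn) : ∀ h : ℕ,
    ∀ (r : ℕ) (u : Fin r → Finset (Fin h)), Function.Injective u → (∀ i, (u i).card ≤ 2) →
      (∀ S : Finset (Fin h), S.card ≤ 2 → ∃ i, u i = S) →
      ∃ P : Fin h → Fin h → ℂ,
        (Matrix.of fun i j : Fin r =>
          ∑ g : (↥(benchCols h r j) → ↥(u i)), (∏ c : ↥(benchCols h r j), P (g c) c) *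
            ∏ a : ↥(u i),
              ((Finset.univ.filter fun c : ↥(benchCols h r j) => g c = a).card.factorial : ℂ)).det ≠ 0 := by
  intro h r u hu hcard hsurj
  have hr : r = windowStart (h + 1) := eq_windowStart_of_enumeration u hu hcard hsurj
  have hr2 : r ≤ 2 ^ h := hr ▸ windowStart_succ_le_two_pow h
  have hr0 : 0 < r := by rw [hr, windowStart]; omega
  exact H h r u hu hcard hsurj (benchCols h r) (benchCols_injective hr2) ⟨⟨0, hr0⟩, benchCols_zero hr0⟩

/-- **GTN ⟹ the free-node benchmark at every height** (compose with the landed `stub_dualisation`). -/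
theorem chowBenchPairs_of_gtn (H : Stmt.gtn) (h : ℕ) :
    ∀ (r : ℕ) (u : Fin r → Finset (Fin h)), Function.Injective u → (∀ i, (u i).card ≤ 2) →
      (∀ S : Finset (Fin h), S.card ≤ 2 → ∃ i, u i = S) →
      ∃ B : Fin h → Fin h → ℂ,
        (Matrix.of fun i j : Fin r => MvPolynomial.coeff
          (∑ a ∈ u i, Finsupp.single (Fin.castAdd h a) 1 +
            ∑ c ∈ benchCols h r j, Finsupp.single (Fin.natAdd h c) 1)
          (∏ a : Fin h, (MvPolynomial.X (Fin.castAdd h a) + 1 +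
            ∑ c : Fin h, MvPolynomial.C (B a c) * MvPolynomial.X (Fin.natAdd h c)))).det ≠ 0 :=
  ChowBenchmarkDual.stub_dualisation h (segmentMeanValue_of_gtn H h)

end Summit.ValiantsHypothesis.ValiantsHypothesis.Theorems.BarrierLever.ChowBenchmarkGTN
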